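import Literature.NumberTheory.EllipticCurves.FormalGroupNegProofs
import Literature.AlgebraicGeometry.Resolution.MvPowerSeriesChainRule
import Mathlib.RingTheory.MvPowerSeries.NoZeroDivisors
import HarnessLib

/-!
# Equal logarithmic derivatives in `u` force proportionality: the Wronskian lemma in `R⟦u, v⟧`
# (the "constant of integration `μ(t₂)`" step of Blakestad–Grant 2023, Prop. 14 — proofs only)

Trunk T-NT-EC (Literature/NumberTheory/EllipticCurves). Pure proof file on the way to the formal
Mazur–Tate theta relation (named fact `WeierstrassCurve.padicSigma_theta_formal`,
`CanonicalPAdicHeightThetaProofs.lean`). Blakestad–Grant integrate twice in `t₁`: "the first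
logarithmic derivatives of both sides in `t₁` differ additively by a function `μ(t₂)` … the ratio
of both sides … is a function `ν(t₂)`. Comparing the expansions of both sides as Laurent
expansions in `t₁` shows that `ν(t₂) = 1`." In `R⟦u, v⟧ = MvPowerSeries (Fin 2) R` (no fraction
field, no Laurent series) the usable form of "`∂ᵤ log f = ∂ᵤ log g` forces `f = ν(v)·g`" is:

* `eq_of_pderiv_mul_eq_of_subst_zero_ne_zero` — **the Wronskian lemma**: over an integral
  domain of characteristic zero, if `∂ᵤf · g = f · ∂ᵤg` and `g(0, v) ≠ 0`, then
  `g(0, v) · f = f(0, v) · g` (the `u`-constants `f(0, v)`, `g(0, v) ∈ R⟦v⟧` read in `R⟦u, v⟧`).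
  Proof: `h = g(0,v)f - f(0,v)g` satisfies the same Wronskian relation and `h(0, v) = 0`; if
  `h ≠ 0` its `u`-adic order `N ≥ 1` (Mathlib's `weightedOrder` for the weight `(1, 0)`) drops to
  `N - 1` under `∂ᵤ` while `g` has `u`-order `0`, so `∂ᵤh · g = h · ∂ᵤg` compares `u`-orders
  `N - 1` and `≥ N` (`MvPowerSeries.weightedOrder_mul`).

Supporting lemmas: the `u`-constants `k(v) = k.subst (X 1)` are killed by `∂ᵤ`
(`pderiv_zero_powerSeries_subst_X_one`) and recovered by `u ↦ 0`
(`subst_zero_X_powerSeries_subst_X_one`); the weight-`(1,0)` order is `≥ 1` exactly when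
`f(0, v) = 0` (`one_le_weightedOrder_of_subst_zero_X_eq_zero`) and is `0` when `f(0, v) ≠ 0`.

## Sources

* C. Blakestad, D. Grant, J. Number Theory 249 (2023) (arXiv:1903.02480), proof of Prop. 14.
* N. Bourbaki, *Algèbre* IV §4 (formal power series, order).

## Design notes

Generic algebra, stated for `MvPowerSeries (Fin 2) R` with `u = X 0`, `v = X 1` and the tree's
"set `u = 0`" substitution `MvPowerSeries.subst ![0, X]` (`FormalGroupNegProofs.lean`). No
definitions, no named facts.
-/

noncomputable section

open PowerSeries
open Literature.AlgebraicGeometry.Resolution (MvPowerSeries.pderiv MvPowerSeries.coeff_pderiv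
  MvPowerSeries.pderiv_powerSeries_subst_X)

namespace Literature.NumberTheory.EllipticCurves

variable {R : Type*} [CommRing R]

/-! ### `u`-constants: `k(v)` read in `R⟦u, v⟧` -/

/-- `∂ᵤ k(v) = 0`. [folklore] -/
theorem pderiv_zero_powerSeries_subst_X_one (k : R⟦X⟧) :
    MvPowerSeries.pderiv 0 (k.subst (MvPowerSeries.X 1 : MvPowerSeries (Fin 2) R)) = 0 := by
  rw [MvPowerSeries.pderiv_powerSeries_subst_X, if_neg (by decide)]

/-- `k(v)|_{u = 0} = k`. [folklore] -/
theorem subst_zero_X_powerSeries_subst_X_one (k : R⟦X⟧) :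
    MvPowerSeries.subst ![(0 : R⟦X⟧), PowerSeries.X]
      (k.subst (MvPowerSeries.X 1 : MvPowerSeries (Fin 2) R)) = k := by
  rw [mvSubst_powerSeries_subst (PowerSeries.HasSubst.X 1) WeierstrassCurve.hasSubst_zero_X,
    MvPowerSeries.subst_X WeierstrassCurve.hasSubst_zero_X]
  exact PowerSeries.X_subst k

/-- `k(u)|_{u = 0} = k(0)`. [folklore] -/
theorem subst_zero_X_powerSeries_subst_X_zero (k : R⟦X⟧) :
    MvPowerSeries.subst ![(0 : R⟦X⟧), PowerSeries.X]
      (k.subst (MvPowerSeries.X 0 : MvPowerSeries (Fin 2) R)) = C (constantCoeff k) := by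
  rw [mvSubst_powerSeries_subst (PowerSeries.HasSubst.X 0) WeierstrassCurve.hasSubst_zero_X,
    MvPowerSeries.subst_X WeierstrassCurve.hasSubst_zero_X]
  show k.subst (0 : R⟦X⟧) = C (constantCoeff k)
  rw [PowerSeries.subst_zero_eq_C_constantCoeff, Algebra.algebraMap_self, MvPowerSeries.map_id]
  rfl

/-- The Wronskian relation is insensitive to `u`-constant factors: if `∂ᵤf·g = f·∂ᵤg` then the
same holds for `a(v)f - b(v)g` against `g`. [folklore] -/
theorem pderiv_wronskian_combination {f g : MvPowerSeries (Fin 2) R}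
    (h : MvPowerSeries.pderiv 0 f * g = f * MvPowerSeries.pderiv 0 g) (a b : R⟦X⟧) :
    MvPowerSeries.pderiv 0 (a.subst (MvPowerSeries.X 1 : MvPowerSeries (Fin 2) R) * f -
        b.subst (MvPowerSeries.X 1 : MvPowerSeries (Fin 2) R) * g) * g =
      (a.subst (MvPowerSeries.X 1 : MvPowerSeries (Fin 2) R) * f -
        b.subst (MvPowerSeries.X 1 : MvPowerSeries (Fin 2) R) * g) * MvPowerSeries.pderiv 0 g := by
  simp only [map_sub, Derivation.leibniz, smul_eq_mul, pderiv_zero_powerSeries_subst_X_one,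
    mul_zero, add_zero]
  linear_combination (a.subst (MvPowerSeries.X 1 : MvPowerSeries (Fin 2) R)) * h

/-! ### The `u`-adic order (weight `(1, 0)`) and the substitution `u ↦ 0` -/

/-- The weight `(1, 0)` on exponents of `R⟦u, v⟧`: `weight d = d 0`, the `u`-degree. [folklore] -/
theorem weight_single_zero_one (d : Fin 2 →₀ ℕ) :
    Finsupp.weight (Pi.single (0 : Fin 2) 1 : Fin 2 → ℕ) d = d 0 :=
  Finsupp.weight_single_one_apply 0 d

/-- **`f(0, v) = 0` forces `u`-order `≥ 1`.** [folklore] -/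
theorem one_le_weightedOrder_of_subst_zero_X_eq_zero {f : MvPowerSeries (Fin 2) R}
    (h : MvPowerSeries.subst ![(0 : R⟦X⟧), PowerSeries.X] f = 0) :
    (1 : ℕ∞) ≤ f.weightedOrder (Pi.single (0 : Fin 2) 1) := by
  refine MvPowerSeries.nat_le_weightedOrder (n := 1) _ fun d hd => ?_
  rw [weight_single_zero_one] at hd
  have hd0 : d 0 = 0 := by omega
  have hd1 : d = Finsupp.single 1 (d 1) := by
    ext i
    fin_cases i
    · simpa using hd0
    · simp
  rw [hd1, ← coeff_subst_zero_X, h, map_zero]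

/-- **`g(0, v) ≠ 0` forces `u`-order `0`.** [folklore] -/
theorem weightedOrder_eq_zero_of_subst_zero_X_ne_zero {g : MvPowerSeries (Fin 2) R}
    (h : MvPowerSeries.subst ![(0 : R⟦X⟧), PowerSeries.X] g ≠ 0) :
    g.weightedOrder (Pi.single (0 : Fin 2) 1) = 0 := by
  obtain ⟨m, hm⟩ : ∃ m, coeff m (MvPowerSeries.subst ![(0 : R⟦X⟧), PowerSeries.X] g) ≠ 0 := by
    by_contra! hall
    exact h (PowerSeries.ext fun m => by rw [hall m, map_zero])
  rw [coeff_subst_zero_X] at hm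
  have hle := MvPowerSeries.weightedOrder_le (Pi.single (0 : Fin 2) 1) hm
  rw [weight_single_zero_one, Finsupp.single_apply, if_neg (by decide), Nat.cast_zero] at hle
  exact le_antisymm hle zero_le

/-- **`∂ᵤ` lowers a positive (finite) `u`-order by exactly one** (characteristic zero). [folklore] -/
theorem weightedOrder_pderiv_zero_eq_sub_one [IsDomain R] [CharZero R]
    {f : MvPowerSeries (Fin 2) R} {N : ℕ}
    (hN : f.weightedOrder (Pi.single (0 : Fin 2) 1) = N) (hN1 : 1 ≤ N) :
    (MvPowerSeries.pderiv 0 f).weightedOrder (Pi.single (0 : Fin 2) 1) = (N - 1 : ℕ) := by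
  rw [MvPowerSeries.weightedOrder_eq_nat] at hN ⊢
  obtain ⟨⟨d, hd, hwd⟩, hlow⟩ := hN
  rw [weight_single_zero_one] at hwd
  refine ⟨⟨d - Finsupp.single 0 1, ?_, ?_⟩, fun e he => ?_⟩
  · have hd' : d - Finsupp.single 0 1 + Finsupp.single 0 1 = d :=
      tsub_add_cancel_of_le (Finsupp.single_le_iff.mpr (by rw [hwd]; exact hN1))
    rw [MvPowerSeries.coeff_pderiv, hd']
    refine mul_ne_zero ?_ hd
    have : ((d - Finsupp.single 0 1 : Fin 2 →₀ ℕ) (0 : Fin 2) : R) + 1 = ((N : ℕ) : R) := by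
      rw [Finsupp.tsub_apply, Finsupp.single_eq_same, hwd]
      push_cast [Nat.cast_sub hN1]
      ring
    rw [this]
    exact_mod_cast (show N ≠ 0 by omega)
  · rw [weight_single_zero_one, Finsupp.tsub_apply, Finsupp.single_eq_same, hwd]
  · rw [weight_single_zero_one] at he
    rw [MvPowerSeries.coeff_pderiv, hlow (e + Finsupp.single 0 1) ?_, mul_zero]
    rw [weight_single_zero_one, Finsupp.add_apply, Finsupp.single_eq_same]
    omega

/-! ### The Wronskian lemma -/

/-- **Vanishing version**: over an integral domain of characteristic zero, if
`∂ᵤh · g = h · ∂ᵤg`, `h(0, v) = 0` and `g(0, v) ≠ 0`, then `h = 0` ("the ratio of both sides is a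
function `ν(t₂)`", here with `ν = h(0,v)/g(0,v) = 0`). [Blakestad–Grant 2023, proof of Prop. 14]
[folklore] -/
theorem eq_zero_of_pderiv_mul_eq [IsDomain R] [CharZero R] {h g : MvPowerSeries (Fin 2) R}
    (hw : MvPowerSeries.pderiv 0 h * g = h * MvPowerSeries.pderiv 0 g)
    (hh : MvPowerSeries.subst ![(0 : R⟦X⟧), PowerSeries.X] h = 0)
    (hg : MvPowerSeries.subst ![(0 : R⟦X⟧), PowerSeries.X] g ≠ 0) : h = 0 := by
  by_contra hne
  set w : Fin 2 → ℕ := Pi.single (0 : Fin 2) 1 with hwdef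
  -- the `u`-order `N ≥ 1` of `h`
  have hfin : (h.weightedOrder w).toNat = h.weightedOrder w :=
    (MvPowerSeries.ne_zero_iff_weightedOrder_finite w).mp hne
  set N := (h.weightedOrder w).toNat with hNdef
  have hN : h.weightedOrder w = N := hfin.symm
  have hN1 : 1 ≤ N := by
    have := one_le_weightedOrder_of_subst_zero_X_eq_zero hh
    rw [← hwdef, hN] at this
    exact_mod_cast this
  -- orders of the two sides of the Wronskian relation
  have hg0 : g.weightedOrder w = 0 := weightedOrder_eq_zero_of_subst_zero_X_ne_zero hg
  have hdh : (MvPowerSeries.pderiv 0 h).weightedOrder w = (N - 1 : ℕ) :=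
    weightedOrder_pderiv_zero_eq_sub_one hN hN1
  have hL : (MvPowerSeries.pderiv 0 h * g).weightedOrder w = (N - 1 : ℕ) := by
    rw [MvPowerSeries.weightedOrder_mul, hdh, hg0, add_zero]
  have hR : (N : ℕ∞) ≤ (h * MvPowerSeries.pderiv 0 g).weightedOrder w := by
    rw [MvPowerSeries.weightedOrder_mul, hN]
    exact le_self_add
  rw [hw] at hL
  rw [hL] at hR
  have : N ≤ N - 1 := by exact_mod_cast hR
  omega

/-- **The Wronskian lemma** ("equal logarithmic `u`-derivatives make the ratio a function of
`v`"): over an integral domain of characteristic zero, if `∂ᵤf · g = f · ∂ᵤg` in `R⟦u, v⟧` and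
`g(0, v) ≠ 0`, then `g(0, v) · f = f(0, v) · g`. [Blakestad–Grant 2023, proof of Prop. 14 ("the
ratio of both sides … is a function `ν(t₂)`")] [folklore] -/
theorem eq_of_pderiv_mul_eq_of_subst_zero_ne_zero [IsDomain R] [CharZero R]
    {f g : MvPowerSeries (Fin 2) R}
    (hw : MvPowerSeries.pderiv 0 f * g = f * MvPowerSeries.pderiv 0 g)
    (hg : MvPowerSeries.subst ![(0 : R⟦X⟧), PowerSeries.X] g ≠ 0) :
    PowerSeries.subst (MvPowerSeries.X 1 : MvPowerSeries (Fin 2) R)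
          (MvPowerSeries.subst ![(0 : R⟦X⟧), PowerSeries.X] g) * f =
      PowerSeries.subst (MvPowerSeries.X 1 : MvPowerSeries (Fin 2) R)
          (MvPowerSeries.subst ![(0 : R⟦X⟧), PowerSeries.X] f) * g := by
  rw [← sub_eq_zero]
  refine eq_zero_of_pderiv_mul_eq (pderiv_wronskian_combination hw _ _) ?_ hg
  have hs := WeierstrassCurve.hasSubst_zero_X (R := R)
  rw [MvPowerSeries.subst_sub hs, MvPowerSeries.subst_mul hs, MvPowerSeries.subst_mul hs,
    subst_zero_X_powerSeries_subst_X_one, subst_zero_X_powerSeries_subst_X_one]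
  ring

end Literature.NumberTheory.EllipticCurves
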